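import Mathlib
import Summits.NavierStokesRegularity.NavierStokesRegularity.Theorems.FilamentSkeletonRssSkeletonJ1RLiaThirdDerivLipschitz
import Summits.NavierStokesRegularity.NavierStokesRegularity.Theorems.FilamentSkeletonRssSkeletonJ1RLiaLipschitzToolsDeriv
import Summits.NavierStokesRegularity.NavierStokesRegularity.Theorems.FilamentSkeletonRssSkeletonJ1RLiaRefEnvelope
import Summits.NavierStokesRegularity.NavierStokesRegularity.Theorems.FilamentSkeletonRssSkeletonJ1RLiaSelfReference

/-!
# Crux `SkeletonJ1R` (stmt-NavierStokesRegularity-23610) · line `streamline_kantorovich_R` · toward stub F2-d (`LiaDefectDerivBL`, v7), brick S4′c for B1′: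
# Γ-UNIFORM WINDOW CEILINGS OF `x‴` — `‖x‴‖ ≤ b·hH` and `Lip(x‴) ≤ b·h′/√Γ` on the window `|r − τ| ≤ r₀√Γ`, `b = 8π/(θp Γ log Γ)`

Hand `leafhand-ns-filamentskeletonrs-1` (gen 1), `--supports stmt-NavierStokesRegularity-23610 --as helper`.  MODEL rung, NEGATIVE side of the ladder:
estimates for a HYPOTHETICAL filament-type blow-up skeleton; nothing here is a claim about Navier–Stokes regularity; the stub and the crux stay OPEN.

`thirdDeriv_window_ceilings` instantiates `…LiaThirdDerivLipschitz.IsLiaReference.thirdDeriv_window_bounds` with the bookkeeping data of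
`…LiaDefectSelfBound.selfTerm_bound` (window `R = r₀√Γ`, `r₀ = e·exp 1/2`; `Xm = bx·(√Γ + |τ|)`, `κw = κ_R = b·kR·(√Γ + |τ|)`, partner distance
`d = ρd√Γ/2`, `Cφ = sup|χ′|`, `D₂ = Lip χ′`) and books every factor against the class constants: there are `hH, h′ ≥ 0` (depending only on
`N, θp, ρd, Rwd, Rb`) with, for `log Γ ≥ 4`, `|τ| ≤ 3ℓ` and `|r − τ| ≤ r₀√Γ`,
`‖x_j‴ r‖ ≤ b·hH` and `‖x_j‴ r − x_j‴ τ‖ ≤ (b·h′/√Γ)|r − τ|`, `b = 8π/(θp Γ log Γ) ≥ |β_j⁻¹|`.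
These are the `hZH`/`hZlip` inputs of `…LiaSelfDerivReference.IsLiaReference.selfDerivStrand_sub_lia_le` in the last (Γ-bookkeeping) file of B1′. [folklore]
-/

-- `dupNamespace` off: the module name repeats `NavierStokesRegularity` by the tree's `Summits/<S>/<S>/Theorems` layout (same as every sibling file).
set_option linter.dupNamespace false
-- `unusedTactic`/`unreachableTactic` off: the `first | (field_simp; ring) | field_simp` closers below are robust to how far `field_simp` normalises.
set_option linter.unusedTactic false
set_option linter.unreachableTactic false

noncomputable section

namespace Summit.NavierStokesRegularity.NavierStokesRegularity.Theorems.SkeletonJ1RFrame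

open Set Function Filter Real Topology MeasureTheory
open Literature.Analysis.FluidPDE Literature.Analysis.Calculus
open scoped InnerProductSpace BigOperators

/-- Sum over the partners of a quantity bounded by `C ≥ 0` is `≤ N·C`. [folklore] -/
theorem sum_erase_le_card_mul {N : ℕ} (j : Fin N) {f : Fin N → ℝ} {C : ℝ} (hC : 0 ≤ C) (hf : ∀ k ∈ Finset.univ.erase j, f k ≤ C) :
    ∑ k ∈ Finset.univ.erase j, f k ≤ N * C := by
  calc ∑ k ∈ Finset.univ.erase j, f k ≤ ∑ k ∈ Finset.univ.erase j, C := Finset.sum_le_sum hf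
    _ = (Finset.univ.erase j).card * C := by rw [Finset.sum_const, nsmul_eq_mul]
    _ ≤ N * C := by
        refine mul_le_mul_of_nonneg_right ?_ hC
        have : (Finset.univ.erase j).card ≤ N := by
          rw [Finset.card_erase_of_mem (Finset.mem_univ j), Finset.card_univ, Fintype.card_fin]; exact Nat.sub_le N 1
        exact_mod_cast this

set_option maxHeartbeats 1600000 in
/-- **Γ-uniform window ceilings of `x‴`** (see the module docstring). [folklore] -/
theorem thirdDeriv_window_ceilings (N : ℕ) {θp ρd Rwd Rb : ℝ} (hθp : 0 < θp) (hρ : 0 < ρd) (hRwd : 0 ≤ Rwd) (hRb : 0 < Rb) :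
    ∃ hH h' : ℝ, 0 ≤ hH ∧ 0 ≤ h' ∧ ∀ {Γ θg : ℝ} {p t : Fin N → EuclideanSpace ℝ (Fin 3)} {γ : Fin N → ℝ} {α : ℝ} {s₀ : Fin N → ℝ}
      {x : Fin N → ℝ → EuclideanSpace ℝ (Fin 3)}, 1 < Γ → 4 ≤ Real.log Γ → IsLiaReference Γ Rb p t γ α s₀ x → (∀ k, ‖t k‖ = 1) →
      0 < θg → θg ≤ 1 → (∀ j k, j ≠ k → |inner ℝ (t j) (t k)| ≤ 1 - θg) →
      (∀ j k, j ≠ k → ∀ a b : ℝ, ρd ≤ ‖(p j + a • t j) - (p k + b • t k)‖) →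
      ∀ (j : Fin N) {θ₁ : ℝ}, 0 ≤ θ₁ →
      (∀ k, k ≠ j → θ₁ ≤ min (Real.sqrt θg / 4) (θg * ρd / (16 * (‖(p j + s₀ j • t j) - (p k + s₀ k • t k)‖ + ρd)))) →
      (∀ σ, ‖deriv (x j) σ - t j‖ ≤ θ₁) → θp ≤ |γ j| → (∀ k, |γ k| ≤ θp⁻¹) → |α| ≤ θp⁻¹ →
      (∀ k, ‖p k + s₀ k • t k‖ ≤ Rwd) → ∀ {τ : ℝ}, |τ| ≤ 3 * Rb * Real.sqrt Γ * Real.sqrt (Real.log Γ) →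
      ∀ r : ℝ, |r - τ| ≤ Real.sqrt (Real.exp (-(1+Real.eulerMascheroniConstant-Real.log 2)) * (1:ℝ)) * Real.exp 1 / 2 * Real.sqrt Γ →
      ‖((liaCoeff Γ γ j)⁻¹ * (deriv Real.smoothTransition (1 - (‖x j r‖ ^ 2 / (Rb * Real.sqrt (Γ * Real.log Γ)) ^ 2 + 1 - 2 * (3 / 2 : ℝ))) *
            (-(2 * ⟪x j r, deriv (x j) r⟫_ℝ / (Rb * Real.sqrt (Γ * Real.log Γ)) ^ 2)))) •
          cross (deriv (x j) r) (ambientField Γ p t γ α s₀ j (x j r)) +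
        ((liaCoeff Γ γ j)⁻¹ * refCutoff (Rb * Real.sqrt (Γ * Real.log Γ)) (x j r)) •
          (cross (deriv (x j) r) (fderiv ℝ (ambientField Γ p t γ α s₀ j) (x j r) (deriv (x j) r)) +
            cross (deriv (deriv (x j)) r) (ambientField Γ p t γ α s₀ j (x j r)))‖ ≤ 8 * Real.pi / (θp * Γ * Real.log Γ) * hH ∧
      ‖(((liaCoeff Γ γ j)⁻¹ * (deriv Real.smoothTransition (1 - (‖x j r‖ ^ 2 / (Rb * Real.sqrt (Γ * Real.log Γ)) ^ 2 + 1 - 2 * (3 / 2 : ℝ))) *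
            (-(2 * ⟪x j r, deriv (x j) r⟫_ℝ / (Rb * Real.sqrt (Γ * Real.log Γ)) ^ 2)))) •
          cross (deriv (x j) r) (ambientField Γ p t γ α s₀ j (x j r)) +
        ((liaCoeff Γ γ j)⁻¹ * refCutoff (Rb * Real.sqrt (Γ * Real.log Γ)) (x j r)) •
          (cross (deriv (x j) r) (fderiv ℝ (ambientField Γ p t γ α s₀ j) (x j r) (deriv (x j) r)) +
            cross (deriv (deriv (x j)) r) (ambientField Γ p t γ α s₀ j (x j r)))) -
        (((liaCoeff Γ γ j)⁻¹ * (deriv Real.smoothTransition (1 - (‖x j τ‖ ^ 2 / (Rb * Real.sqrt (Γ * Real.log Γ)) ^ 2 + 1 - 2 * (3 / 2 : ℝ))) *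
            (-(2 * ⟪x j τ, deriv (x j) τ⟫_ℝ / (Rb * Real.sqrt (Γ * Real.log Γ)) ^ 2)))) •
          cross (deriv (x j) τ) (ambientField Γ p t γ α s₀ j (x j τ)) +
        ((liaCoeff Γ γ j)⁻¹ * refCutoff (Rb * Real.sqrt (Γ * Real.log Γ)) (x j τ)) •
          (cross (deriv (x j) τ) (fderiv ℝ (ambientField Γ p t γ α s₀ j) (x j τ) (deriv (x j) τ)) +
            cross (deriv (deriv (x j)) τ) (ambientField Γ p t γ α s₀ j (x j τ))))‖ ≤
        8 * Real.pi / (θp * Γ * Real.log Γ) * h' / Real.sqrt Γ * |r - τ| := by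
  -- universal constants
  set a₀ : ℝ := Real.exp (-(1+Real.eulerMascheroniConstant-Real.log 2)) * (1:ℝ) with ha₀
  have ha₀0 : 0 < a₀ := coreConst_pos
  set e : ℝ := Real.sqrt a₀ with he
  have he0 : 0 < e := Real.sqrt_pos.2 ha₀0
  set r₀ : ℝ := e * Real.exp 1 / 2 with hr₀
  have hr₀0 : 0 < r₀ := by positivity
  obtain ⟨Cφ, hCφ0, hCφ⟩ := exists_bound_deriv_smoothTransition
  obtain ⟨D₂, hD₂0, hD₂lip⟩ := exists_deriv_smoothTransition_lipschitz
  -- class constants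
  set B₀ : ℝ := N / (Real.pi * θp * ρd) with hB₀
  set Q₀ : ℝ := 1 / 2 + θp⁻¹ with hQ₀
  set e₀ : ℝ := B₀ + Q₀ * Rwd with he₀
  set kR : ℝ := e₀ + Q₀ * (1 + r₀) with hkR
  set cu : ℝ := 1 + 3 * Rb with hcu
  set bx : ℝ := Rwd + 1 + r₀ with hbx
  set wb : ℝ := B₀ + Q₀ * bx with hwb
  set lw : ℝ := 24 * N / (Real.pi * θp * ρd ^ 2) + Q₀ with hlw
  set a₁ : ℝ := 2 * Cφ * bx * cu / Rb ^ 2 with ha₁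
  set kw : ℝ := 8 * Real.pi * kR * wb * cu ^ 2 / θp with hkw
  set xk : ℝ := 8 * Real.pi * kR * bx * cu ^ 2 / θp with hxk
  set kc : ℝ := 8 * Real.pi * kR * cu / θp with hkc
  set hH : ℝ := a₁ * wb * cu + lw + kw with hhH
  set lam₀ : ℝ := 4 * D₂ * bx ^ 2 * cu ^ 2 / Rb ^ 4 + 2 * Cφ * (1 + xk) / Rb ^ 2 with hlam₀
  set l₂ : ℝ := 56 * N / (Real.pi * θp * ρd ^ 3) + 6 * N * kc / (Real.pi * θp * ρd ^ 2) + Q₀ * kc with hl₂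
  set h' : ℝ := lam₀ * wb * cu + 2 * a₁ * (kw + lw) + 2 * kc * lw + l₂ + 8 * Real.pi * hH * wb * cu / θp with hh'
  have hB₀0 : 0 ≤ B₀ := by positivity
  have hQ₀0 : 0 < Q₀ := by positivity
  have he₀0 : 0 ≤ e₀ := by positivity
  have hkR0 : 0 < kR := by positivity
  have hcu0 : 0 < cu := by positivity
  have hbx0 : 0 < bx := by positivity
  have hwb0 : 0 < wb := by positivity
  have hlw0 : 0 < lw := by positivity
  have ha₁0 : 0 ≤ a₁ := by positivity
  have hkw0 : 0 ≤ kw := by positivity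
  have hxk0 : 0 ≤ xk := by positivity
  have hkc0 : 0 ≤ kc := by positivity
  have hhH0 : 0 ≤ hH := by positivity
  have hlam₀0 : 0 ≤ lam₀ := by positivity
  have hl₂0 : 0 ≤ l₂ := by positivity
  have hh'0 : 0 ≤ h' := by positivity
  refine ⟨hH, h', hhH0, hh'0, ?_⟩
  intro Γ θg p t γ α s₀ x hΓ hL4 hx ht hθg hθg1 hgp hsep j θ₁ hθ₁0 hθ₁A htilt hγlo hγhi hα hq τ hτ r hr
  -- Γ-level quantities
  have hΓ0 : 0 < Γ := by linarith
  set G := Real.sqrt Γ with hG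
  have hG0 : 0 < G := Real.sqrt_pos.2 hΓ0
  have hGG : G ^ 2 = Γ := Real.sq_sqrt hΓ0.le
  set L := Real.log Γ with hL
  have hL0 : 0 < L := by linarith
  set sL := Real.sqrt L with hsL
  have hsL0 : 0 < sL := Real.sqrt_pos.2 hL0
  have hsLL : sL ^ 2 = L := Real.sq_sqrt hL0.le
  have hsL1 : 1 ≤ sL := by rw [hsL, ← Real.sqrt_one]; exact Real.sqrt_le_sqrt (by linarith)
  have hsqrtΓL : Real.sqrt (Γ * L) = G * sL := Real.sqrt_mul hΓ0.le L
  set ℓ := Rb * Real.sqrt (Γ * Real.log Γ) with hℓdef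
  have hℓeq : ℓ = Rb * G * sL := by rw [hℓdef, ← hL, hsqrtΓL, mul_assoc]
  have hℓ0 : 0 < ℓ := by rw [hℓeq]; positivity
  have hℓ2 : ℓ ^ 2 = Rb ^ 2 * (Γ * L) := by rw [hℓeq, ← hGG, ← hsLL]; ring
  -- u and its bounds
  set u := G + |τ| with hu
  have hu0 : 0 < u := by positivity
  have hGu : G ≤ u := by rw [hu]; linarith [abs_nonneg τ]
  have hτu : |τ| ≤ u := by rw [hu]; linarith
  have hucu : u ≤ cu * G * sL := by
    have h1 : G ≤ G * sL := le_mul_of_one_le_right hG0.le hsL1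
    have hτ' : |τ| ≤ 3 * Rb * G * sL := hτ
    have heq : cu * G * sL = G * sL + 3 * Rb * G * sL := by rw [hcu]; ring
    rw [heq, hu]; linarith
  have hu2 : u ^ 2 ≤ cu ^ 2 * Γ * L := by
    have h := pow_le_pow_left₀ hu0.le hucu 2
    calc u ^ 2 ≤ (cu * G * sL) ^ 2 := h
      _ = cu ^ 2 * Γ * L := by rw [mul_pow, mul_pow, hGG, hsLL]
  -- β and b
  set β := liaCoeff Γ γ j with hβ
  have hγj : 0 < |γ j| := hθp.trans_le hγlo
  set b : ℝ := 8 * Real.pi / (θp * Γ * L) with hb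
  have hb0 : 0 < b := by positivity
  have hβinv : |β⁻¹| ≤ b := by
    rw [hβ, abs_inv]; unfold liaCoeff
    rw [hb, abs_div, abs_mul, abs_mul, abs_of_pos hΓ0, abs_of_pos hL0, abs_of_pos (by positivity : (0:ℝ) < 8 * Real.pi), inv_div]
    refine div_le_div_of_nonneg_left (by positivity) (by positivity) ?_
    calc θp * Γ * L = θp * (Γ * L) := by ring
      _ ≤ |γ j| * (Γ * L) := mul_le_mul_of_nonneg_right hγlo (by positivity)
      _ = Γ * |γ j| * L := by ring
  have hbΓL : b * (Γ * L) = 8 * Real.pi / θp := by rw [hb]; first | (field_simp; ring) | field_simp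
  have hbGsL : b * (G * sL) = 8 * Real.pi / θp / (G * sL) := by
    rw [hb, ← hGG, ← hsLL]; first | (field_simp; ring) | field_simp
  have h4π : (0:ℝ) < 4 * Real.pi := by positivity
  have hγθ : ∀ k, |γ k| * θp ≤ 1 := fun k => by rw [← le_div_iff₀ hθp, one_div]; exact hγhi k
  have hck : ∀ k, |Γ * γ k / (4 * Real.pi)| ≤ Γ / (4 * Real.pi * θp) := fun k => by
    rw [abs_div, abs_mul, abs_of_pos hΓ0, abs_of_pos h4π, div_le_div_iff₀ h4π (by positivity)]
    calc Γ * |γ k| * (4 * Real.pi * θp) = (|γ k| * θp) * (4 * Real.pi * Γ) := by ring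
      _ ≤ 1 * (4 * Real.pi * Γ) := mul_le_mul_of_nonneg_right (hγθ k) (by positivity)
      _ = Γ * (4 * Real.pi) := by ring
  -- geometric quantities of the reference
  set d : ℝ := ρd / 2 * G with hd
  have hd0 : 0 < d := by positivity
  set Bd : ℝ := ∑ k ∈ Finset.univ.erase j, |Γ * γ k / (4 * Real.pi)| * (2 / d) with hBd
  have hBdle : Bd ≤ B₀ * G := by
    have hterm : ∀ k ∈ Finset.univ.erase j, |Γ * γ k / (4 * Real.pi)| * (2 / d) ≤ G / (Real.pi * θp * ρd) := by
      intro k _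
      calc |Γ * γ k / (4 * Real.pi)| * (2 / d) ≤ Γ / (4 * Real.pi * θp) * (2 / d) := mul_le_mul_of_nonneg_right (hck k) (by positivity)
        _ = G / (Real.pi * θp * ρd) := by rw [hd, ← hGG]; first | (field_simp; ring) | field_simp
    calc Bd ≤ N * (G / (Real.pi * θp * ρd)) := sum_erase_le_card_mul j (by positivity) hterm
      _ = B₀ * G := by rw [hB₀]; ring
  have hBd0 : 0 ≤ Bd := Finset.sum_nonneg fun k _ => by positivity
  set Q : ℝ := 1 / 2 + |α| with hQdef
  have hQ : Q ≤ Q₀ := by rw [hQdef, hQ₀]; linarith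
  have hQ0 : 0 < Q := by positivity
  have hw : ‖waistPt Γ p t s₀ j‖ ≤ Rwd * G := by
    rw [waistPt_eq, norm_smul, Real.norm_of_nonneg hG0.le, mul_comm]; exact mul_le_mul_of_nonneg_right (hq j) hG0.le
  -- partner distance everywhere, curvature envelope
  have hfar : ∀ σ, ∀ k, k ≠ j → d ^ 2 ≤ ‖x j σ - waistPt Γ p t s₀ k‖ ^ 2 - (inner ℝ (x j σ - waistPt Γ p t s₀ k) (t k)) ^ 2 :=
    fun σ => hx.dist_partner_ge_of_tilt ht hθg hθg1 hgp hρ hsep j hθ₁0 hθ₁A htilt σ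
  set ε₀ := b * e₀ * G with hε₀
  set ε₁ := b * Q₀ with hε₁
  have henv : ∀ σ, ‖deriv (deriv (x j)) σ‖ ≤ ε₀ + ε₁ * |σ| := by
    intro σ
    have h := hx.curvature_envelope ht j σ hd0 (hfar σ)
    have h2 : Bd + (1/2 + |α|) * (‖waistPt Γ p t s₀ j‖ + |σ|) ≤ e₀ * G + Q₀ * |σ| := by
      have hm : (1/2 + |α|) * (‖waistPt Γ p t s₀ j‖ + |σ|) ≤ Q₀ * (Rwd * G + |σ|) :=
        mul_le_mul hQ (add_le_add hw (le_refl |σ|)) (by positivity) hQ₀0.le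
      calc _ ≤ B₀ * G + Q₀ * (Rwd * G + |σ|) := add_le_add hBdle hm
        _ = e₀ * G + Q₀ * |σ| := by rw [he₀]; ring
    calc ‖deriv (deriv (x j)) σ‖ ≤ |β⁻¹| * (Bd + (1/2 + |α|) * (‖waistPt Γ p t s₀ j‖ + |σ|)) := h
      _ ≤ b * (e₀ * G + Q₀ * |σ|) := mul_le_mul hβinv h2 (by positivity) hb0.le
      _ = ε₀ + ε₁ * |σ| := by rw [hε₀, hε₁]; ring
  -- the window and its data
  set R := r₀ * G with hR
  have hR0 : 0 < R := by positivity
  have hrR : |r - τ| ≤ R := hr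
  set κR := b * kR * u with hκR
  have hκR0 : 0 ≤ κR := by positivity
  have hκRenv : ε₀ + ε₁ * (|τ| + R) ≤ κR := by
    have hbe : b * e₀ * G ≤ b * e₀ * u := mul_le_mul_of_nonneg_left hGu (by positivity)
    have hbq : b * Q₀ * |τ| ≤ b * Q₀ * u := mul_le_mul_of_nonneg_left hτu (by positivity)
    have hbr : b * Q₀ * (r₀ * G) ≤ b * Q₀ * (r₀ * u) := mul_le_mul_of_nonneg_left (mul_le_mul_of_nonneg_left hGu hr₀0.le) (by positivity)
    have heq : κR = b * e₀ * u + b * Q₀ * u + b * Q₀ * (r₀ * u) := by rw [hκR, hkR]; ring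
    have heq2 : ε₀ + ε₁ * (|τ| + R) = b * e₀ * G + b * Q₀ * |τ| + b * Q₀ * (r₀ * G) := by rw [hε₀, hε₁, hR]; ring
    rw [heq, heq2]; linarith
  have hκww : ∀ s, |s - τ| ≤ R → ‖deriv (deriv (x j)) s‖ ≤ κR := by
    intro s hs
    have h1 : |s| ≤ |τ| + R := by
      have := abs_sub_abs_le_abs_sub s τ; linarith
    calc ‖deriv (deriv (x j)) s‖ ≤ ε₀ + ε₁ * |s| := henv s
      _ ≤ ε₀ + ε₁ * (|τ| + R) := by
          have hε₁0 : 0 ≤ ε₁ := by positivity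
          exact add_le_add le_rfl (mul_le_mul_of_nonneg_left h1 hε₁0)
      _ ≤ κR := hκRenv
  set Xm := bx * u with hXm
  have hXm0 : 0 ≤ Xm := by positivity
  have hXw : ∀ s, |s - τ| ≤ R → ‖x j s‖ ≤ Xm := by
    intro s hs
    have h1 : |s| ≤ |τ| + R := by
      have := abs_sub_abs_le_abs_sub s τ; linarith
    have h2 := hx.norm_le j s
    have h3 : Rwd * G ≤ Rwd * u := mul_le_mul_of_nonneg_left hGu hRwd
    have h4 : r₀ * G ≤ r₀ * u := mul_le_mul_of_nonneg_left hGu hr₀0.le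
    have heq : Xm = Rwd * u + u + r₀ * u := by rw [hXm, hbx]; ring
    rw [heq]; rw [hR] at h1; linarith
  have hfarW : ∀ s, |s - τ| ≤ R → ∀ k, k ≠ j →
      d ^ 2 ≤ ‖x j s - waistPt Γ p t s₀ k‖ ^ 2 - (inner ℝ (x j s - waistPt Γ p t s₀ k) (t k)) ^ 2 := fun s _ => hfar s
  have hττ : |τ - τ| ≤ R := by rw [sub_self, abs_zero]; exact hR0.le
  -- brick S4′b
  obtain ⟨h1, h2⟩ := hx.thirdDeriv_window_bounds ht j hd0 hXm0 hκR0 hD₂0 hCφ hD₂lip hℓ0 hXw hκww hfarW hrR hττ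
  -- the factor ceilings
  have hratio : 2 * Xm / ℓ ^ 2 ≤ 2 * bx * cu / (Rb ^ 2 * (G * sL)) := by
    rw [hXm, hℓeq, div_le_div_iff₀ (by positivity) (by positivity)]
    calc 2 * (bx * u) * (Rb ^ 2 * (G * sL)) ≤ 2 * (bx * (cu * G * sL)) * (Rb ^ 2 * (G * sL)) := by gcongr
      _ = 2 * bx * cu * (Rb * G * sL) ^ 2 := by ring
  have hratio0 : 0 ≤ 2 * Xm / ℓ ^ 2 := by positivity
  have hA₁ : Cφ * (2 * Xm / ℓ ^ 2) ≤ a₁ / (G * sL) := by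
    calc Cφ * (2 * Xm / ℓ ^ 2) ≤ Cφ * (2 * bx * cu / (Rb ^ 2 * (G * sL))) := mul_le_mul_of_nonneg_left hratio hCφ0
      _ = a₁ / (G * sL) := by rw [ha₁]; first | (field_simp; ring) | field_simp
  have hA₁G : Cφ * (2 * Xm / ℓ ^ 2) ≤ a₁ / G :=
    hA₁.trans (div_le_div_of_nonneg_left ha₁0 hG0 (le_mul_of_one_le_right hG0.le hsL1))
  have hM : Bd + Q * Xm ≤ wb * u := by
    have h1 : B₀ * G ≤ B₀ * u := mul_le_mul_of_nonneg_left hGu hB₀0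
    have h2 : Q * Xm ≤ Q₀ * (bx * u) := mul_le_mul hQ hXm.le hXm0 hQ₀0.le
    have heq : wb * u = B₀ * u + Q₀ * (bx * u) := by rw [hwb]; ring
    rw [heq]; linarith
  have hM0 : 0 ≤ Bd + Q * Xm := by positivity
  have hMc : Bd + Q * Xm ≤ wb * (cu * G * sL) := hM.trans (mul_le_mul_of_nonneg_left hucu hwb0.le)
  have hA₁M : Cφ * (2 * Xm / ℓ ^ 2) * (Bd + Q * Xm) ≤ a₁ * wb * cu := by
    calc Cφ * (2 * Xm / ℓ ^ 2) * (Bd + Q * Xm) ≤ a₁ / (G * sL) * (wb * (cu * G * sL)) := mul_le_mul hA₁ hMc hM0 (by positivity)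
      _ = a₁ * wb * cu := by first | (field_simp; ring) | field_simp
  set LL : ℝ := (∑ k ∈ Finset.univ.erase j, |Γ * γ k / (4 * Real.pi)| * (6 / (d / 2) ^ 2)) + Q with hLL
  have hLLle : LL ≤ lw := by
    have hterm : ∀ k ∈ Finset.univ.erase j, |Γ * γ k / (4 * Real.pi)| * (6 / (d / 2) ^ 2) ≤ 24 / (Real.pi * θp * ρd ^ 2) := by
      intro k _
      calc |Γ * γ k / (4 * Real.pi)| * (6 / (d / 2) ^ 2) ≤ Γ / (4 * Real.pi * θp) * (6 / (d / 2) ^ 2) :=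
            mul_le_mul_of_nonneg_right (hck k) (by positivity)
        _ = 24 / (Real.pi * θp * ρd ^ 2) := by rw [hd, ← hGG]; first | (field_simp; ring) | field_simp
    have hsum := sum_erase_le_card_mul j (by positivity) hterm
    rw [hLL, hlw]
    have : (N : ℝ) * (24 / (Real.pi * θp * ρd ^ 2)) = 24 * N / (Real.pi * θp * ρd ^ 2) := by ring
    linarith
  have hLL0 : 0 ≤ LL := by
    have : 0 ≤ ∑ k ∈ Finset.univ.erase j, |Γ * γ k / (4 * Real.pi)| * (6 / (d / 2) ^ 2) := Finset.sum_nonneg fun k _ => by positivity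
    rw [hLL]; positivity
  have hκRM : κR * (Bd + Q * Xm) ≤ kw := by
    calc κR * (Bd + Q * Xm) ≤ (b * kR * u) * (wb * u) := mul_le_mul_of_nonneg_left hM hκR0
      _ = b * (kR * wb) * u ^ 2 := by ring
      _ ≤ b * (kR * wb) * (cu ^ 2 * Γ * L) := mul_le_mul_of_nonneg_left hu2 (by positivity)
      _ = kw := by rw [hkw, show b * (kR * wb) * (cu ^ 2 * Γ * L) = (b * (Γ * L)) * kR * wb * cu ^ 2 by ring, hbΓL]; ring
  have hHx : |β⁻¹| * (Cφ * (2 * Xm / ℓ ^ 2) * (Bd + Q * Xm) + LL + κR * (Bd + Q * Xm)) ≤ b * hH := by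
    have hs : Cφ * (2 * Xm / ℓ ^ 2) * (Bd + Q * Xm) + LL + κR * (Bd + Q * Xm) ≤ hH := by rw [hhH]; linarith
    exact mul_le_mul hβinv hs (by positivity) hb0.le
  refine ⟨h1.trans hHx, h2.trans (mul_le_mul_of_nonneg_right ?_ (abs_nonneg _))⟩
  -- the Lipschitz ceiling
  have hκRb : κR ≤ kc / (G * sL) := by
    calc κR ≤ b * kR * (cu * G * sL) := mul_le_mul_of_nonneg_left hucu (by positivity)
      _ = kR * cu * (b * (G * sL)) := by ring
      _ = kc / (G * sL) := by rw [hbGsL, hkc]; first | (field_simp; ring) | field_simp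
  have hκRG : κR ≤ kc / G := hκRb.trans (div_le_div_of_nonneg_left hkc0 hG0 (le_mul_of_one_le_right hG0.le hsL1))
  have hXκ : Xm * κR ≤ xk := by
    calc Xm * κR = b * (kR * bx) * u ^ 2 := by rw [hXm, hκR]; ring
      _ ≤ b * (kR * bx) * (cu ^ 2 * Γ * L) := mul_le_mul_of_nonneg_left hu2 (by positivity)
      _ = xk := by rw [hxk, show b * (kR * bx) * (cu ^ 2 * Γ * L) = (b * (Γ * L)) * kR * bx * cu ^ 2 by ring, hbΓL]; ring
  have hΛx : D₂ * (2 * Xm / ℓ ^ 2) ^ 2 + Cφ * (2 * (1 + Xm * κR) / ℓ ^ 2) ≤ lam₀ / (Γ * L) := by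
    have hsq : (2 * Xm / ℓ ^ 2) ^ 2 ≤ 4 * bx ^ 2 * cu ^ 2 / Rb ^ 4 / (Γ * L) := by
      calc (2 * Xm / ℓ ^ 2) ^ 2 ≤ (2 * bx * cu / (Rb ^ 2 * (G * sL))) ^ 2 := pow_le_pow_left₀ hratio0 hratio 2
        _ = 4 * bx ^ 2 * cu ^ 2 / Rb ^ 4 / (Γ * L) := by rw [← hGG, ← hsLL]; first | (field_simp; ring) | field_simp
    have hlin : 2 * (1 + Xm * κR) / ℓ ^ 2 ≤ 2 * (1 + xk) / Rb ^ 2 / (Γ * L) := by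
      rw [hℓ2, div_div]
      exact div_le_div_of_nonneg_right (by linarith) (by positivity)
    calc D₂ * (2 * Xm / ℓ ^ 2) ^ 2 + Cφ * (2 * (1 + Xm * κR) / ℓ ^ 2)
        ≤ D₂ * (4 * bx ^ 2 * cu ^ 2 / Rb ^ 4 / (Γ * L)) + Cφ * (2 * (1 + xk) / Rb ^ 2 / (Γ * L)) :=
          add_le_add (mul_le_mul_of_nonneg_left hsq hD₂0) (mul_le_mul_of_nonneg_left hlin hCφ0)
      _ = lam₀ / (Γ * L) := by rw [hlam₀]; first | (field_simp; ring) | field_simp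
  have hΛ0 : 0 ≤ D₂ * (2 * Xm / ℓ ^ 2) ^ 2 + Cφ * (2 * (1 + Xm * κR) / ℓ ^ 2) := by positivity
  have hΛM : (D₂ * (2 * Xm / ℓ ^ 2) ^ 2 + Cφ * (2 * (1 + Xm * κR) / ℓ ^ 2)) * (Bd + Q * Xm) ≤ lam₀ * wb * cu / G := by
    calc _ ≤ lam₀ / (Γ * L) * (wb * (cu * G * sL)) := mul_le_mul hΛx hMc hM0 (by positivity)
      _ = lam₀ * wb * cu / (G * sL) := by rw [← hGG, ← hsLL]; first | (field_simp; ring) | field_simp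
      _ ≤ lam₀ * wb * cu / G := div_le_div_of_nonneg_left (by positivity) hG0 (le_mul_of_one_le_right hG0.le hsL1)
  have h2nd : 2 * (Cφ * (2 * Xm / ℓ ^ 2)) * (κR * (Bd + Q * Xm) + LL) ≤ 2 * a₁ * (kw + lw) / G := by
    calc 2 * (Cφ * (2 * Xm / ℓ ^ 2)) * (κR * (Bd + Q * Xm) + LL) ≤ 2 * (a₁ / G) * (kw + lw) :=
          mul_le_mul (mul_le_mul_of_nonneg_left hA₁G (by norm_num)) (add_le_add hκRM hLLle) (by positivity) (by positivity)
      _ = 2 * a₁ * (kw + lw) / G := by first | (field_simp; ring) | field_simp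
  have h3rd : 2 * κR * LL ≤ 2 * kc * lw / G := by
    calc 2 * κR * LL ≤ 2 * (kc / G) * lw := mul_le_mul (mul_le_mul_of_nonneg_left hκRG (by norm_num)) hLLle hLL0 (by positivity)
      _ = 2 * kc * lw / G := by first | (field_simp; ring) | field_simp
  set L₂ : ℝ := (∑ k ∈ Finset.univ.erase j, |Γ * γ k / (4 * Real.pi)| * (28 / d ^ 3 + 6 * κR / d ^ 2)) + Q * κR with hL₂
  have hL₂le : L₂ ≤ l₂ / G := by
    have hterm : ∀ k ∈ Finset.univ.erase j, |Γ * γ k / (4 * Real.pi)| * (28 / d ^ 3 + 6 * κR / d ^ 2) ≤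
        (56 / (Real.pi * θp * ρd ^ 3) + 6 * kc / (Real.pi * θp * ρd ^ 2)) / G := by
      intro k _
      have hin : 28 / d ^ 3 + 6 * κR / d ^ 2 ≤ 28 / d ^ 3 + 6 * (kc / G) / d ^ 2 := by gcongr
      calc |Γ * γ k / (4 * Real.pi)| * (28 / d ^ 3 + 6 * κR / d ^ 2) ≤ Γ / (4 * Real.pi * θp) * (28 / d ^ 3 + 6 * (kc / G) / d ^ 2) :=
            mul_le_mul (hck k) hin (by positivity) (by positivity)
        _ = (56 / (Real.pi * θp * ρd ^ 3) + 6 * kc / (Real.pi * θp * ρd ^ 2)) / G := by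
            rw [hd, ← hGG]; first | (field_simp; ring) | field_simp
    have hsum := sum_erase_le_card_mul j (by positivity) hterm
    have hQκ : Q * κR ≤ Q₀ * (kc / G) := mul_le_mul hQ hκRG hκR0 hQ₀0.le
    calc L₂ ≤ N * ((56 / (Real.pi * θp * ρd ^ 3) + 6 * kc / (Real.pi * θp * ρd ^ 2)) / G) + Q₀ * (kc / G) := add_le_add hsum hQκ
      _ = l₂ / G := by rw [hl₂]; first | (field_simp; ring) | field_simp
  have hHxM : |β⁻¹| * (Cφ * (2 * Xm / ℓ ^ 2) * (Bd + Q * Xm) + LL + κR * (Bd + Q * Xm)) * (Bd + Q * Xm) ≤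
      8 * Real.pi * hH * wb * cu / θp / G := by
    calc _ ≤ b * hH * (wb * (cu * G * sL)) := mul_le_mul hHx hMc hM0 (by positivity)
      _ = hH * wb * cu * (b * (G * sL)) := by ring
      _ = 8 * Real.pi * hH * wb * cu / θp / (G * sL) := by rw [hbGsL]; first | (field_simp; ring) | field_simp
      _ ≤ 8 * Real.pi * hH * wb * cu / θp / G :=
          div_le_div_of_nonneg_left (by positivity) hG0 (le_mul_of_one_le_right hG0.le hsL1)
  have htot : (D₂ * (2 * Xm / ℓ ^ 2) ^ 2 + Cφ * (2 * (1 + Xm * κR) / ℓ ^ 2)) * (Bd + Q * Xm) +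
      2 * (Cφ * (2 * Xm / ℓ ^ 2)) * (κR * (Bd + Q * Xm) + LL) +
      (2 * κR * LL + L₂ + |β⁻¹| * (Cφ * (2 * Xm / ℓ ^ 2) * (Bd + Q * Xm) + LL + κR * (Bd + Q * Xm)) * (Bd + Q * Xm)) ≤ h' / G := by
    have heq : h' / G = lam₀ * wb * cu / G + 2 * a₁ * (kw + lw) / G + (2 * kc * lw / G + l₂ / G + 8 * Real.pi * hH * wb * cu / θp / G) := by
      rw [hh']; first | (field_simp; ring) | field_simp
    rw [heq]
    exact add_le_add (add_le_add hΛM h2nd) (add_le_add (add_le_add h3rd hL₂le) hHxM)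
  have htot0 : 0 ≤ (D₂ * (2 * Xm / ℓ ^ 2) ^ 2 + Cφ * (2 * (1 + Xm * κR) / ℓ ^ 2)) * (Bd + Q * Xm) +
      2 * (Cφ * (2 * Xm / ℓ ^ 2)) * (κR * (Bd + Q * Xm) + LL) +
      (2 * κR * LL + L₂ + |β⁻¹| * (Cφ * (2 * Xm / ℓ ^ 2) * (Bd + Q * Xm) + LL + κR * (Bd + Q * Xm)) * (Bd + Q * Xm)) := by
    have : 0 ≤ L₂ := by
      have : 0 ≤ ∑ k ∈ Finset.univ.erase j, |Γ * γ k / (4 * Real.pi)| * (28 / d ^ 3 + 6 * κR / d ^ 2) :=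
        Finset.sum_nonneg fun k _ => by positivity
      rw [hL₂]; positivity
    positivity
  calc _ ≤ b * (h' / G) := mul_le_mul hβinv htot htot0 hb0.le
    _ = 8 * Real.pi / (θp * Γ * Real.log Γ) * h' / Real.sqrt Γ := by rw [hb, hG, hL]; ring
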